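/-
COR-CM (cell pub-hodgecm2, stage 2 of the Hodge ladder) — count-neutral KERNEL COMBINATORICS «the abelian numerals»
(seat prover-pub-hodgecm2-b23-g39-0, binder prover b23, gen 39; claim ABELIAN-DATUM D9, HOME/INBOX.md; blanket `CorCM/FaceAbelian*`).  Theorems
only: D4's presentation-form exactness with the orbit numerals of gens 36/37 and seat b17 (`Census/EvenSliceOrbitCount{,B}.lean`,
`Census/OddDegreeParityLawRelative.lean`, `Census/OddDegreeParityLawCyclicPrime.lean`) BY NAME; no geometry, no named fact, nothing asserted;
`Interfaces.lean` (C1), every E term, B01 and `Transposition/*` are untouched.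
HONEST FRAMING (COORDINATOR RULING — HODGE FRAMING CORRECTION, 2026-08-21T11:55:35Z): `HC_CM` is NOT proved, here or anywhere in the
tree; this file counts faces and produces no period.
T5: n/a-class — no HC-level conclusion; checker: self (prover-pub-hodgecm2-b23-g39-0), 2026-08-23.
-/
import Summits.HodgeConjecture.CorCM.FaceAbelianExact
import Summits.HodgeConjecture.CorCM.Census.EvenSliceOrbitCount
import Summits.HodgeConjecture.CorCM.Census.EvenSliceOrbitCountB
import Summits.HodgeConjecture.CorCM.Census.OddDegreeParityLawRelative
import HarnessLib

/-!
# The abelian numerals: exact least face numbers for abelian Galois CM fields, by the group `A = Aut(K)/⟨c⟩ ≅ Gal(K⁺/ℚ)`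

The abelian analogue of `CorCM/FaceCyclicBlockNumerals.lean`.  `F` a Galois CM field with COMMUTATIVE `Aut(F)`; `c` the automorphism inducing
complex conjugation at the base embedding `σ₀`, NOT A SQUARE in `Aut(F)` (⟺ `F` has an imaginary quadratic subfield,
`CorCM/FaceAbelianImaginaryQuadratic.lean`; automatic when `[F:ℚ]/2` is odd, D1 `not_isSquare_conjAut_of_odd`); `π : Aut(F) ↠ A` ANY presentation
of `Aut(F)/⟨c⟩` onto the listed concrete group `A` (additive on products, `π c = 0`, kernel `{1, c}`, onto).  Then the least number of rank-four
faces of `F` with the INT2-GEN binder `hgen(𝒮, σ₀)` is EXACTLY (D4 `isLeast_card_faces_hgen_of_presentation_{odd,even}` + the numerals):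

| `A ≅ Gal(F⁺/ℚ)` | `[F:ℚ]` | `#OrbitsA A` | least #faces | numeral |
|---|---|---|---|---|
| `ℤ/p`, `p ≥ 3` prime | `2p` | `(2^p − 2)/2p` | `(2^p − 2)/2p` | b17 `card_orbits_eq` |
| `ℤ/9` | 18 | 29 | **29** | b17 `card_orbitsA_zmod_nine` |
| `(ℤ/3)²` | 18 | 31 | **31** | b17 `card_orbitsA_zmod_three_sq` |
| `ℤ/15` | 30 | 1095 | **1095** | b17 `card_orbitsA_zmod_fifteen` |
| `ℤ/4` | 8 | 3 | **2** | gen 37 `card_orbitsA_zmod_four` |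
| `(ℤ/2)²` | 8 | 4 | **3** | gen 37 |
| `ℤ/6` | 12 | 7 | **6** | gen 37 |
| `ℤ/8` | 16 | 19 | **18** | gen 37 |
| `ℤ/2 × ℤ/4` | 16 | 23 | **22** | gen 37 (B) |
| `(ℤ/2)³` | 16 | 29 | **28** | gen 37 |
| `ℤ/10` | 20 | 55 | **54** | gen 37 |
| `ℤ/12` | 24 | 179 | **178** | gen 37 |
| `ℤ/2 × ℤ/6` | 24 | 189 | **188** | gen 37 (B) |

(e.g. `ℚ(i, √2, √3, √5)`-type fields `Gal ≅ (ℤ/2)⁴`: `28`; an imaginary quadratic field times the real cyclic sextic `ℚ(ζ₇ + ζ₇⁻¹, √d)`…: by the row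
of `Gal(F⁺/ℚ)`.)  `HC_CM` is NOT proved; no period is produced.

References: [cite: Pohlmann1968, Thm. 1]; [cite: Milne1999LefschetzClasses, Thm. 3.2, Prop. 2.1]; [cite: Shimura1998, §8.1 (p. 62)].
-/

noncomputable section

open NumberField NumberField.ComplexEmbedding

namespace Summit.HodgeConjecture.CorCM.FaceAbelian

open Summit.HodgeConjecture.CorCM.Prior.AllgGroup.RfwfAllgGroup
open Summit.HodgeConjecture.CorCM.Census.OddDegreeParityLaw
open Summit.HodgeConjecture.CorCM.Census.EvenSliceOrbitCount

variable {F : Type} [Field F] [NumberField F]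

/-! ## Half-degree odd -/

/-- **`A ≅ ℤ/p`, `p ≥ 3` prime: exactly `(2^p − 2)/2p` generating faces** (`1, 3, 9, 93, 315, 3855, …` for `p = 3, 5, 7, 11, 13, 17, …`).
[cite: Pohlmann1968, Thm. 1] [cite: Milne1999LefschetzClasses, Thm. 3.2] -/
theorem isLeast_card_faces_hgen_of_presentation_zmod_prime [IsCMField F] [IsGalois ℚ F] {p : ℕ} [hp : Fact p.Prime] (hp3 : 3 ≤ p)
    (hcomm : ∀ g h : F ≃ₐ[ℚ] F, g * h = h * g) (σ₀ : F →+* ℂ) {c : F ≃ₐ[ℚ] F} (hcσ : σ₀.comp (c : F →+* F) = conjugate σ₀)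
    (hns : ¬ IsSquare c) (π : (F ≃ₐ[ℚ] F) → ZMod p) (hπ : ∀ g h, π (g * h) = π g + π h) (hπc : π c = 0)
    (hker : ∀ g, π g = 0 → g = 1 ∨ g = c) (hsurj : Function.Surjective π) :
    IsLeast {m : ℕ | ∃ 𝒮 : Finset (Face F), 𝒮.card = m ∧
      ∀ f : Face F, lefChar f.corner (fun _ => ({σ₀} : Finset (F →+* ℂ))) ∈ AddSubgroup.closure
        {a : Asym F | ∃ g ∈ (𝒮 : Set (Face F)), ∃ σ : F →+* ℂ, a = lefChar g.corner (fun _ => ({σ} : Finset (F →+* ℂ)))}}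
      ((2 ^ p - 2) / (2 * p)) := by
  have hp2 : p ≠ 2 := by omega
  have h := isLeast_card_faces_hgen_of_presentation_odd hcomm σ₀ hcσ hns π hπ hπc hker hsurj
    (by rw [ZMod.card]; exact hp.out.odd_of_ne_two hp2) (by rw [ZMod.card]; exact hp3)
  rwa [← Nat.card_eq_fintype_card, card_orbits_eq p hp2] at h

/-- **`A ≅ ℤ/9`: exactly `29` generating faces, none fewer.** [cite: Pohlmann1968, Thm. 1] [cite: Milne1999LefschetzClasses, Thm. 3.2] -/
theorem isLeast_card_faces_hgen_of_presentation_zmod_nine [IsCMField F] [IsGalois ℚ F]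
    (hcomm : ∀ g h : F ≃ₐ[ℚ] F, g * h = h * g) (σ₀ : F →+* ℂ) {c : F ≃ₐ[ℚ] F} (hcσ : σ₀.comp (c : F →+* F) = conjugate σ₀)
    (hns : ¬ IsSquare c) (π : (F ≃ₐ[ℚ] F) → ZMod 9) (hπ : ∀ g h, π (g * h) = π g + π h) (hπc : π c = 0)
    (hker : ∀ g, π g = 0 → g = 1 ∨ g = c) (hsurj : Function.Surjective π) :
    IsLeast {m : ℕ | ∃ 𝒮 : Finset (Face F), 𝒮.card = m ∧
      ∀ f : Face F, lefChar f.corner (fun _ => ({σ₀} : Finset (F →+* ℂ))) ∈ AddSubgroup.closure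
        {a : Asym F | ∃ g ∈ (𝒮 : Set (Face F)), ∃ σ : F →+* ℂ, a = lefChar g.corner (fun _ => ({σ} : Finset (F →+* ℂ)))}}
      29 := by
  have h := isLeast_card_faces_hgen_of_presentation_odd hcomm σ₀ hcσ hns π hπ hπc hker hsurj (by simp only [ZMod.card]; decide) (by simp only [ZMod.card]; norm_num)
  rwa [← Nat.card_eq_fintype_card, card_orbitsA_zmod_nine] at h

/-- **`A ≅ (ℤ/3)²`: exactly `31` generating faces, none fewer.** [cite: Pohlmann1968, Thm. 1] [cite: Milne1999LefschetzClasses, Thm. 3.2] -/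
theorem isLeast_card_faces_hgen_of_presentation_zmod_three_sq [IsCMField F] [IsGalois ℚ F]
    (hcomm : ∀ g h : F ≃ₐ[ℚ] F, g * h = h * g) (σ₀ : F →+* ℂ) {c : F ≃ₐ[ℚ] F} (hcσ : σ₀.comp (c : F →+* F) = conjugate σ₀)
    (hns : ¬ IsSquare c) (π : (F ≃ₐ[ℚ] F) → ZMod 3 × ZMod 3) (hπ : ∀ g h, π (g * h) = π g + π h) (hπc : π c = 0)
    (hker : ∀ g, π g = 0 → g = 1 ∨ g = c) (hsurj : Function.Surjective π) :
    IsLeast {m : ℕ | ∃ 𝒮 : Finset (Face F), 𝒮.card = m ∧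
      ∀ f : Face F, lefChar f.corner (fun _ => ({σ₀} : Finset (F →+* ℂ))) ∈ AddSubgroup.closure
        {a : Asym F | ∃ g ∈ (𝒮 : Set (Face F)), ∃ σ : F →+* ℂ, a = lefChar g.corner (fun _ => ({σ} : Finset (F →+* ℂ)))}}
      31 := by
  have h := isLeast_card_faces_hgen_of_presentation_odd hcomm σ₀ hcσ hns π hπ hπc hker hsurj (by simp only [Fintype.card_prod, ZMod.card]; decide) (by simp only [Fintype.card_prod, ZMod.card]; norm_num)
  rwa [← Nat.card_eq_fintype_card, card_orbitsA_zmod_three_sq] at h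

/-- **`A ≅ ℤ/15`: exactly `1095` generating faces, none fewer.** [cite: Pohlmann1968, Thm. 1] [cite: Milne1999LefschetzClasses, Thm. 3.2] -/
theorem isLeast_card_faces_hgen_of_presentation_zmod_fifteen [IsCMField F] [IsGalois ℚ F]
    (hcomm : ∀ g h : F ≃ₐ[ℚ] F, g * h = h * g) (σ₀ : F →+* ℂ) {c : F ≃ₐ[ℚ] F} (hcσ : σ₀.comp (c : F →+* F) = conjugate σ₀)
    (hns : ¬ IsSquare c) (π : (F ≃ₐ[ℚ] F) → ZMod 15) (hπ : ∀ g h, π (g * h) = π g + π h) (hπc : π c = 0)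
    (hker : ∀ g, π g = 0 → g = 1 ∨ g = c) (hsurj : Function.Surjective π) :
    IsLeast {m : ℕ | ∃ 𝒮 : Finset (Face F), 𝒮.card = m ∧
      ∀ f : Face F, lefChar f.corner (fun _ => ({σ₀} : Finset (F →+* ℂ))) ∈ AddSubgroup.closure
        {a : Asym F | ∃ g ∈ (𝒮 : Set (Face F)), ∃ σ : F →+* ℂ, a = lefChar g.corner (fun _ => ({σ} : Finset (F →+* ℂ)))}}
      1095 := by
  have h := isLeast_card_faces_hgen_of_presentation_odd hcomm σ₀ hcσ hns π hπ hπc hker hsurj (by simp only [ZMod.card]; decide) (by simp only [ZMod.card]; norm_num)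
  rwa [← Nat.card_eq_fintype_card, card_orbitsA_zmod_fifteen] at h

/-! ## Half-degree even -/

/-- **`A ≅ ℤ/4`: exactly `2` generating faces, none fewer.** [cite: Pohlmann1968, Thm. 1] [cite: Milne1999LefschetzClasses, Thm. 3.2] -/
theorem isLeast_card_faces_hgen_of_presentation_zmod_four [IsCMField F] [IsGalois ℚ F]
    (hcomm : ∀ g h : F ≃ₐ[ℚ] F, g * h = h * g) (σ₀ : F →+* ℂ) {c : F ≃ₐ[ℚ] F} (hcσ : σ₀.comp (c : F →+* F) = conjugate σ₀)
    (hns : ¬ IsSquare c) (π : (F ≃ₐ[ℚ] F) → ZMod 4) (hπ : ∀ g h, π (g * h) = π g + π h) (hπc : π c = 0)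
    (hker : ∀ g, π g = 0 → g = 1 ∨ g = c) (hsurj : Function.Surjective π) :
    IsLeast {m : ℕ | ∃ 𝒮 : Finset (Face F), 𝒮.card = m ∧
      ∀ f : Face F, lefChar f.corner (fun _ => ({σ₀} : Finset (F →+* ℂ))) ∈ AddSubgroup.closure
        {a : Asym F | ∃ g ∈ (𝒮 : Set (Face F)), ∃ σ : F →+* ℂ, a = lefChar g.corner (fun _ => ({σ} : Finset (F →+* ℂ)))}}
      2 := by
  have h := isLeast_card_faces_hgen_of_presentation_even hcomm σ₀ hcσ hns π hπ hπc hker hsurj (by simp only [ZMod.card]; decide) (by rw [ZMod.card])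
  rwa [← Nat.card_eq_fintype_card, card_orbitsA_zmod_four] at h

/-- **`A ≅ (ℤ/2)²`: exactly `3` generating faces, none fewer.** [cite: Pohlmann1968, Thm. 1] [cite: Milne1999LefschetzClasses, Thm. 3.2] -/
theorem isLeast_card_faces_hgen_of_presentation_zmod_two_sq [IsCMField F] [IsGalois ℚ F]
    (hcomm : ∀ g h : F ≃ₐ[ℚ] F, g * h = h * g) (σ₀ : F →+* ℂ) {c : F ≃ₐ[ℚ] F} (hcσ : σ₀.comp (c : F →+* F) = conjugate σ₀)
    (hns : ¬ IsSquare c) (π : (F ≃ₐ[ℚ] F) → ZMod 2 × ZMod 2) (hπ : ∀ g h, π (g * h) = π g + π h) (hπc : π c = 0)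
    (hker : ∀ g, π g = 0 → g = 1 ∨ g = c) (hsurj : Function.Surjective π) :
    IsLeast {m : ℕ | ∃ 𝒮 : Finset (Face F), 𝒮.card = m ∧
      ∀ f : Face F, lefChar f.corner (fun _ => ({σ₀} : Finset (F →+* ℂ))) ∈ AddSubgroup.closure
        {a : Asym F | ∃ g ∈ (𝒮 : Set (Face F)), ∃ σ : F →+* ℂ, a = lefChar g.corner (fun _ => ({σ} : Finset (F →+* ℂ)))}}
      3 := by
  have h := isLeast_card_faces_hgen_of_presentation_even hcomm σ₀ hcσ hns π hπ hπc hker hsurj (by simp only [Fintype.card_prod, ZMod.card]; decide) (by simp only [Fintype.card_prod, ZMod.card]; norm_num)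
  rwa [← Nat.card_eq_fintype_card, card_orbitsA_zmod_two_sq] at h

/-- **`A ≅ ℤ/6`: exactly `6` generating faces, none fewer.** [cite: Pohlmann1968, Thm. 1] [cite: Milne1999LefschetzClasses, Thm. 3.2] -/
theorem isLeast_card_faces_hgen_of_presentation_zmod_six [IsCMField F] [IsGalois ℚ F]
    (hcomm : ∀ g h : F ≃ₐ[ℚ] F, g * h = h * g) (σ₀ : F →+* ℂ) {c : F ≃ₐ[ℚ] F} (hcσ : σ₀.comp (c : F →+* F) = conjugate σ₀)
    (hns : ¬ IsSquare c) (π : (F ≃ₐ[ℚ] F) → ZMod 6) (hπ : ∀ g h, π (g * h) = π g + π h) (hπc : π c = 0)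
    (hker : ∀ g, π g = 0 → g = 1 ∨ g = c) (hsurj : Function.Surjective π) :
    IsLeast {m : ℕ | ∃ 𝒮 : Finset (Face F), 𝒮.card = m ∧
      ∀ f : Face F, lefChar f.corner (fun _ => ({σ₀} : Finset (F →+* ℂ))) ∈ AddSubgroup.closure
        {a : Asym F | ∃ g ∈ (𝒮 : Set (Face F)), ∃ σ : F →+* ℂ, a = lefChar g.corner (fun _ => ({σ} : Finset (F →+* ℂ)))}}
      6 := by
  have h := isLeast_card_faces_hgen_of_presentation_even hcomm σ₀ hcσ hns π hπ hπc hker hsurj (by simp only [ZMod.card]; decide) (by simp only [ZMod.card]; norm_num)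
  rwa [← Nat.card_eq_fintype_card, card_orbitsA_zmod_six] at h

/-- **`A ≅ ℤ/8`: exactly `18` generating faces, none fewer.** [cite: Pohlmann1968, Thm. 1] [cite: Milne1999LefschetzClasses, Thm. 3.2] -/
theorem isLeast_card_faces_hgen_of_presentation_zmod_eight [IsCMField F] [IsGalois ℚ F]
    (hcomm : ∀ g h : F ≃ₐ[ℚ] F, g * h = h * g) (σ₀ : F →+* ℂ) {c : F ≃ₐ[ℚ] F} (hcσ : σ₀.comp (c : F →+* F) = conjugate σ₀)
    (hns : ¬ IsSquare c) (π : (F ≃ₐ[ℚ] F) → ZMod 8) (hπ : ∀ g h, π (g * h) = π g + π h) (hπc : π c = 0)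
    (hker : ∀ g, π g = 0 → g = 1 ∨ g = c) (hsurj : Function.Surjective π) :
    IsLeast {m : ℕ | ∃ 𝒮 : Finset (Face F), 𝒮.card = m ∧
      ∀ f : Face F, lefChar f.corner (fun _ => ({σ₀} : Finset (F →+* ℂ))) ∈ AddSubgroup.closure
        {a : Asym F | ∃ g ∈ (𝒮 : Set (Face F)), ∃ σ : F →+* ℂ, a = lefChar g.corner (fun _ => ({σ} : Finset (F →+* ℂ)))}}
      18 := by
  have h := isLeast_card_faces_hgen_of_presentation_even hcomm σ₀ hcσ hns π hπ hπc hker hsurj (by simp only [ZMod.card]; decide) (by simp only [ZMod.card]; norm_num)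
  rwa [← Nat.card_eq_fintype_card, card_orbitsA_zmod_eight] at h

/-- **`A ≅ ℤ/2 × ℤ/4`: exactly `22` generating faces, none fewer.** [cite: Pohlmann1968, Thm. 1] [cite: Milne1999LefschetzClasses, Thm. 3.2] -/
theorem isLeast_card_faces_hgen_of_presentation_zmod_two_four [IsCMField F] [IsGalois ℚ F]
    (hcomm : ∀ g h : F ≃ₐ[ℚ] F, g * h = h * g) (σ₀ : F →+* ℂ) {c : F ≃ₐ[ℚ] F} (hcσ : σ₀.comp (c : F →+* F) = conjugate σ₀)
    (hns : ¬ IsSquare c) (π : (F ≃ₐ[ℚ] F) → ZMod 2 × ZMod 4) (hπ : ∀ g h, π (g * h) = π g + π h) (hπc : π c = 0)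
    (hker : ∀ g, π g = 0 → g = 1 ∨ g = c) (hsurj : Function.Surjective π) :
    IsLeast {m : ℕ | ∃ 𝒮 : Finset (Face F), 𝒮.card = m ∧
      ∀ f : Face F, lefChar f.corner (fun _ => ({σ₀} : Finset (F →+* ℂ))) ∈ AddSubgroup.closure
        {a : Asym F | ∃ g ∈ (𝒮 : Set (Face F)), ∃ σ : F →+* ℂ, a = lefChar g.corner (fun _ => ({σ} : Finset (F →+* ℂ)))}}
      22 := by
  have h := isLeast_card_faces_hgen_of_presentation_even hcomm σ₀ hcσ hns π hπ hπc hker hsurj (by simp only [Fintype.card_prod, ZMod.card]; decide) (by simp only [Fintype.card_prod, ZMod.card]; norm_num)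
  rwa [← Nat.card_eq_fintype_card, card_orbitsA_zmod_two_four] at h

/-- **`A ≅ (ℤ/2)³`: exactly `28` generating faces, none fewer.** [cite: Pohlmann1968, Thm. 1] [cite: Milne1999LefschetzClasses, Thm. 3.2] -/
theorem isLeast_card_faces_hgen_of_presentation_zmod_two_cube [IsCMField F] [IsGalois ℚ F]
    (hcomm : ∀ g h : F ≃ₐ[ℚ] F, g * h = h * g) (σ₀ : F →+* ℂ) {c : F ≃ₐ[ℚ] F} (hcσ : σ₀.comp (c : F →+* F) = conjugate σ₀)
    (hns : ¬ IsSquare c) (π : (F ≃ₐ[ℚ] F) → ZMod 2 × ZMod 2 × ZMod 2) (hπ : ∀ g h, π (g * h) = π g + π h) (hπc : π c = 0)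
    (hker : ∀ g, π g = 0 → g = 1 ∨ g = c) (hsurj : Function.Surjective π) :
    IsLeast {m : ℕ | ∃ 𝒮 : Finset (Face F), 𝒮.card = m ∧
      ∀ f : Face F, lefChar f.corner (fun _ => ({σ₀} : Finset (F →+* ℂ))) ∈ AddSubgroup.closure
        {a : Asym F | ∃ g ∈ (𝒮 : Set (Face F)), ∃ σ : F →+* ℂ, a = lefChar g.corner (fun _ => ({σ} : Finset (F →+* ℂ)))}}
      28 := by
  have h := isLeast_card_faces_hgen_of_presentation_even hcomm σ₀ hcσ hns π hπ hπc hker hsurj (by simp only [Fintype.card_prod, ZMod.card]; decide) (by simp only [Fintype.card_prod, ZMod.card]; norm_num)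
  rwa [← Nat.card_eq_fintype_card, card_orbitsA_zmod_two_cube] at h

/-- **`A ≅ ℤ/10`: exactly `54` generating faces, none fewer.** [cite: Pohlmann1968, Thm. 1] [cite: Milne1999LefschetzClasses, Thm. 3.2] -/
theorem isLeast_card_faces_hgen_of_presentation_zmod_ten [IsCMField F] [IsGalois ℚ F]
    (hcomm : ∀ g h : F ≃ₐ[ℚ] F, g * h = h * g) (σ₀ : F →+* ℂ) {c : F ≃ₐ[ℚ] F} (hcσ : σ₀.comp (c : F →+* F) = conjugate σ₀)
    (hns : ¬ IsSquare c) (π : (F ≃ₐ[ℚ] F) → ZMod 10) (hπ : ∀ g h, π (g * h) = π g + π h) (hπc : π c = 0)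
    (hker : ∀ g, π g = 0 → g = 1 ∨ g = c) (hsurj : Function.Surjective π) :
    IsLeast {m : ℕ | ∃ 𝒮 : Finset (Face F), 𝒮.card = m ∧
      ∀ f : Face F, lefChar f.corner (fun _ => ({σ₀} : Finset (F →+* ℂ))) ∈ AddSubgroup.closure
        {a : Asym F | ∃ g ∈ (𝒮 : Set (Face F)), ∃ σ : F →+* ℂ, a = lefChar g.corner (fun _ => ({σ} : Finset (F →+* ℂ)))}}
      54 := by
  have h := isLeast_card_faces_hgen_of_presentation_even hcomm σ₀ hcσ hns π hπ hπc hker hsurj (by simp only [ZMod.card]; decide) (by simp only [ZMod.card]; norm_num)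
  rwa [← Nat.card_eq_fintype_card, card_orbitsA_zmod_ten] at h

/-- **`A ≅ ℤ/12`: exactly `178` generating faces, none fewer.** [cite: Pohlmann1968, Thm. 1] [cite: Milne1999LefschetzClasses, Thm. 3.2] -/
theorem isLeast_card_faces_hgen_of_presentation_zmod_twelve [IsCMField F] [IsGalois ℚ F]
    (hcomm : ∀ g h : F ≃ₐ[ℚ] F, g * h = h * g) (σ₀ : F →+* ℂ) {c : F ≃ₐ[ℚ] F} (hcσ : σ₀.comp (c : F →+* F) = conjugate σ₀)
    (hns : ¬ IsSquare c) (π : (F ≃ₐ[ℚ] F) → ZMod 12) (hπ : ∀ g h, π (g * h) = π g + π h) (hπc : π c = 0)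
    (hker : ∀ g, π g = 0 → g = 1 ∨ g = c) (hsurj : Function.Surjective π) :
    IsLeast {m : ℕ | ∃ 𝒮 : Finset (Face F), 𝒮.card = m ∧
      ∀ f : Face F, lefChar f.corner (fun _ => ({σ₀} : Finset (F →+* ℂ))) ∈ AddSubgroup.closure
        {a : Asym F | ∃ g ∈ (𝒮 : Set (Face F)), ∃ σ : F →+* ℂ, a = lefChar g.corner (fun _ => ({σ} : Finset (F →+* ℂ)))}}
      178 := by
  have h := isLeast_card_faces_hgen_of_presentation_even hcomm σ₀ hcσ hns π hπ hπc hker hsurj (by simp only [ZMod.card]; decide) (by simp only [ZMod.card]; norm_num)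
  rwa [← Nat.card_eq_fintype_card, card_orbitsA_zmod_twelve] at h

/-- **`A ≅ ℤ/2 × ℤ/6`: exactly `188` generating faces, none fewer.** [cite: Pohlmann1968, Thm. 1] [cite: Milne1999LefschetzClasses, Thm. 3.2] -/
theorem isLeast_card_faces_hgen_of_presentation_zmod_two_six [IsCMField F] [IsGalois ℚ F]
    (hcomm : ∀ g h : F ≃ₐ[ℚ] F, g * h = h * g) (σ₀ : F →+* ℂ) {c : F ≃ₐ[ℚ] F} (hcσ : σ₀.comp (c : F →+* F) = conjugate σ₀)
    (hns : ¬ IsSquare c) (π : (F ≃ₐ[ℚ] F) → ZMod 2 × ZMod 6) (hπ : ∀ g h, π (g * h) = π g + π h) (hπc : π c = 0)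
    (hker : ∀ g, π g = 0 → g = 1 ∨ g = c) (hsurj : Function.Surjective π) :
    IsLeast {m : ℕ | ∃ 𝒮 : Finset (Face F), 𝒮.card = m ∧
      ∀ f : Face F, lefChar f.corner (fun _ => ({σ₀} : Finset (F →+* ℂ))) ∈ AddSubgroup.closure
        {a : Asym F | ∃ g ∈ (𝒮 : Set (Face F)), ∃ σ : F →+* ℂ, a = lefChar g.corner (fun _ => ({σ} : Finset (F →+* ℂ)))}}
      188 := by
  have h := isLeast_card_faces_hgen_of_presentation_even hcomm σ₀ hcσ hns π hπ hπc hker hsurj (by simp only [Fintype.card_prod, ZMod.card]; decide) (by simp only [Fintype.card_prod, ZMod.card]; norm_num)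
  rwa [← Nat.card_eq_fintype_card, card_orbitsA_zmod_two_six] at h

end Summit.HodgeConjecture.CorCM.FaceAbelian

end
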